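import Mathlib.MeasureTheory.Integral.Bochner.ContinuousLinearMap
import Literature.Analysis.FunctionSpaces.TorusTrigPoly
import Literature.Analysis.FunctionSpaces.TorusImprovedHolderTwoSided
import Literature.Analysis.FluidPDE.MikadoShearPotential
import HarnessLib

/-!
# Averages against the squared shear phase: `∫ f sin²(2πN η·x) dx = ½∫ f + O(‖f‖_{C¹}/N)`
# (Coiculescu–Palasek 2025, Lemma 3.2 (4): `A_{j,k} ∼ δ`)

Analysis/FluidPDE support file (all results proved; no definitions, no named facts), continuing
`MikadoShearPotential` (the phase `CP25.shearPhase k Λ x = Re(Λ e_k(x))` of the Mikado potentials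
of M. P. Coiculescu, S. Palasek, *Non-uniqueness of smooth solutions of the Navier–Stokes equations
from critical data*, Invent. Math. 244 (2025), arXiv:2503.14699, Def. 3.1). The normalising
constants of the datum (Lemma 3.2 (4), Def. 3.5)

  `A_{j,k} = ⨍ φ̃_j²(M_k x) sin²(N_k(x - x_j)·η_j) dx ∼ δ`

are averages of a slowly varying function (`φ̃_j²(M_k·)`, Lipschitz constant `O(M_k)`) against the
squared phase at the much finer scale `N_k⁻¹`; the paper obtains `A_{j,k} ∼ δ` by "an easy
application of [the improved Hölder inequality, App. A Lemma A.2], using `⨍ φ̃_j² ∼ δ` and that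
`N_k/M_k` can be made larger than any absolute constant". This file proves the quantitative
two-sided statement behind it, for the phase frequency `k = N • η`:

* `CP25.mFourier_nsmul`, `CP25.mFourier_apply_nsmul` — `e_{nk} = e_kⁿ = e_k(n•·)`, whence
  `e_{Nη}(κ/N) = 1` (`CP25.mFourier_natCast_zsmul_proj_cellCorner`) and the **`(1/N)ℤ^d`-invariance
  of the phase** `Re(Λ e_{Nη})` (`CP25.shearPhase_add_proj_cellCorner`);
* `CP25.shearPhase_sq_eq` — `Re(Λe_k)² = (‖Λ‖² + Re(Λ² e_{2k}))/2`, and **`∫ Re(Λe_k)² = ‖Λ‖²/2`** for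
  `k ≠ 0` (`CP25.integral_shearPhase_sq`);
* `CP25.abs_integral_mul_shearPhase_sq_sub_le` — **Lemma 3.2 (4), abstract form**: for `f` with
  `|f| ≤ B` and `L`-Lipschitz lift, `N ≥ 1`, `η ≠ 0`:
  `|∫ f · Re(Λe_{Nη})² - (‖Λ‖²/2) ∫ f| ≤ (L √d / N) · ‖Λ‖²/2`
  (the two-sided improved Hölder inequality at `p = 1`,
  `Torus.abs_integral_mul_sub_le_of_latticeInvariant`, with the invariant weight `Re(Λe_{Nη})² ≥ 0`).
  With `f = φ̃_j²(M_k ·)` (`|f| ≤ 1`, Lipschitz constant `∝ M_k`), `Λ` unimodular and `∫ φ̃_j² ∼ δ`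
  this is `A_{j,k} = ½⨍φ̃_j² + O(M_k/N_k) ∼ δ`.

## References

* M. P. Coiculescu, S. Palasek, Invent. Math. 244 (2025) 165–219, doi:10.1007/s00222-025-01396-z,
  arXiv:2503.14699: Lemma 3.2 (4) and its proof, App. A Lemma A.2, Def. 3.5. [CoiculescuPalasek2025]
* S. Modena, L. Székelyhidi Jr., Ann. PDE 4 (2018), no. 18, Lemma 2.1. [ModenaSzekelyhidi2018]
-/

noncomputable section

open MeasureTheory Set Function UnitAddTorus
open scoped BigOperators

namespace Literature.Analysis.FluidPDE

namespace CP25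

open Literature.Analysis.FunctionSpaces Literature.Analysis.FunctionSpaces.Torus

variable {d : Type*} [Fintype d] [DecidableEq d]

/-! ## Characters at multiples: `e_{nk} = e_kⁿ = e_k(n • ·)` -/

omit [DecidableEq d] in
/-- `e_{n k}(x) = e_k(x)ⁿ`. [folklore] -/
theorem mFourier_nsmul (n : ℕ) (k : d → ℤ) (x : UnitAddTorus d) :
    mFourier (n • k) x = mFourier k x ^ n := by
  induction n with
  | zero => simp [mFourier_zero]
  | succ n ih => rw [succ_nsmul, mFourier_add, ih, pow_succ]

omit [DecidableEq d] in
/-- `e_k(n • x) = e_k(x)ⁿ`. [folklore] -/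
theorem mFourier_apply_nsmul (n : ℕ) (k : d → ℤ) (x : UnitAddTorus d) :
    mFourier k (n • x) = mFourier k x ^ n := by
  induction n with
  | zero =>
    rw [zero_nsmul, pow_zero]
    have h := Torus.mFourier_apply_add k (0 : UnitAddTorus d) 0
    rw [add_zero] at h
    have h1 : mFourier k (0 : UnitAddTorus d) ≠ 0 := by
      intro h0
      have := congrArg norm h0
      simp [mFourier] at this
    -- `e(0) = e(0)²` and `e(0) ≠ 0`
    have h2 : mFourier k (0 : UnitAddTorus d) * (mFourier k 0 - 1) = 0 := by
      rw [mul_sub, mul_one, ← h, sub_self]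
    rcases mul_eq_zero.1 h2 with h3 | h3
    · exact absurd h3 h1
    · exact sub_eq_zero.1 h3
  | succ n ih => rw [succ_nsmul, Torus.mFourier_apply_add, ih, pow_succ]

/-- **`e_{Nη}(κ/N) = 1`**: the character of frequency `N η` is trivial on the finer lattice
`(1/N)ℤ^d` (`e_{Nη}(κ/N) = e_η(N • κ/N) = e_η(κ) = e_η(0) = 1`). [folklore] -/
theorem mFourier_natCast_zsmul_proj_cellCorner {N : ℕ} (hN : 0 < N) (η : d → ℤ) (κ : d → Fin N) :
    mFourier ((N : ℤ) • η) (proj (cellCorner N κ)) = 1 := by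
  rw [natCast_zsmul, mFourier_nsmul, ← mFourier_apply_nsmul]
  have h : N • proj (cellCorner N κ) = (0 : UnitAddTorus d) := by
    rw [← proj_natCast_smul, cellCorner, smul_smul,
      mul_inv_cancel₀ (Nat.cast_ne_zero.2 hN.ne'), one_smul, proj_latticeVec]
  rw [h, ← zero_nsmul (0 : UnitAddTorus d), mFourier_apply_nsmul, pow_zero]

/-- **The phase of frequency `Nη` is `(1/N)ℤ^d`-invariant**: `Re(Λe_{Nη}(x + κ/N)) = Re(Λe_{Nη}(x))`
— the hypothesis `hper` of the improved Hölder inequalities of `TorusImprovedHolder(TwoSided)`.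
[cite: CoiculescuPalasek2025, Lemma 3.2 (4) (proof: "an easy application of Lemma A.2")] -/
theorem shearPhase_add_proj_cellCorner {N : ℕ} (hN : 0 < N) (η : d → ℤ) (Λ : ℂ)
    (x : UnitAddTorus d) (κ : d → Fin N) :
    shearPhase ((N : ℤ) • η) Λ (x + proj (cellCorner N κ)) = shearPhase ((N : ℤ) • η) Λ x := by
  unfold shearPhase
  rw [Torus.mFourier_apply_add, mFourier_natCast_zsmul_proj_cellCorner hN, mul_one]

/-! ## The square of the phase and its average -/

omit [DecidableEq d] in
/-- For `z ∈ ℂ`: `(Re z)² = (‖z‖² + Re(z²))/2`. [folklore] -/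
theorem re_sq_eq_half (z : ℂ) : z.re ^ 2 = (‖z‖ ^ 2 + (z ^ 2).re) / 2 := by
  rw [Complex.sq_norm, Complex.normSq_apply, pow_two z, Complex.mul_re]
  ring

omit [DecidableEq d] in
/-- **The squared phase**: `Re(Λe_k(x))² = (‖Λ‖² + Re(Λ² e_{2k}(x)))/2`. [folklore] -/
theorem shearPhase_sq_eq (k : d → ℤ) (Λ : ℂ) (x : UnitAddTorus d) :
    shearPhase k Λ x ^ 2 = (‖Λ‖ ^ 2 + (Λ ^ 2 * mFourier (k + k) x).re) / 2 := by
  unfold shearPhase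
  rw [re_sq_eq_half, norm_mul]
  have h1 : ‖mFourier k x‖ = 1 := by simp [mFourier]
  rw [h1, mul_one, mul_pow, pow_two (mFourier k x), ← mFourier_add]

omit [DecidableEq d] in
/-- `0 ≤ Re(Λe_k)²` and `Re(Λe_k)² ≤ ‖Λ‖²`. [folklore] -/
theorem shearPhase_sq_le (k : d → ℤ) (Λ : ℂ) (x : UnitAddTorus d) :
    shearPhase k Λ x ^ 2 ≤ ‖Λ‖ ^ 2 := by
  have h := abs_shearPhase_le k Λ x
  have h2 : |shearPhase k Λ x| ^ 2 ≤ ‖Λ‖ ^ 2 := pow_le_pow_left₀ (abs_nonneg _) h 2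
  rwa [sq_abs] at h2

omit [DecidableEq d] in
/-- The squared phase is continuous. [folklore] -/
theorem continuous_shearPhase_sq (k : d → ℤ) (Λ : ℂ) :
    Continuous fun x : UnitAddTorus d => shearPhase k Λ x ^ 2 := by
  have h : Continuous (shearPhase (d := d) k Λ) := by
    unfold shearPhase
    exact Complex.continuous_re.comp (continuous_const.mul (mFourier k).continuous)
  exact h.pow 2

omit [DecidableEq d] in
/-- **`∫_{T^d} Re(Λe_k)² = ‖Λ‖²/2` for `k ≠ 0`** (`∫ e_{2k} = 0`). [folklore] -/
theorem integral_shearPhase_sq {k : d → ℤ} (hk : k ≠ 0) (Λ : ℂ) :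
    ∫ x, shearPhase k Λ x ^ 2 = ‖Λ‖ ^ 2 / 2 := by
  simp_rw [shearPhase_sq_eq]
  have hkk : k + k ≠ 0 := by
    intro h
    apply hk
    funext i
    have := congrFun h i
    simp only [Pi.add_apply, Pi.zero_apply] at this ⊢
    omega
  have hint : Integrable (fun x : UnitAddTorus d => Λ ^ 2 * mFourier (k + k) x) volume :=
    ((continuous_const.mul (mFourier (k + k)).continuous).integrable_of_hasCompactSupport
      (HasCompactSupport.of_compactSpace _))
  have hre : ∫ x, (Λ ^ 2 * mFourier (k + k) x).re = 0 := by
    have h1 := integral_re hint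
    simp only [RCLike.re_to_complex] at h1
    rw [h1, integral_const_mul, integral_mFourier, if_neg hkk, mul_zero, Complex.zero_re]
  have hint2 : Integrable (fun x : UnitAddTorus d => (Λ ^ 2 * mFourier (k + k) x).re) volume :=
    hint.re
  rw [integral_div, integral_add (integrable_const _) hint2, hre, add_zero, integral_const]
  simp

/-! ## Lemma 3.2 (4): averages against the squared phase -/

/-- **Coiculescu–Palasek 2025, Lemma 3.2 (4) (`A_{j,k} ∼ δ`), abstract form.** For `f : T^d → ℝ`
with `|f| ≤ B` and `L`-Lipschitz lift, a frequency vector `η ≠ 0`, `N ≥ 1` and `Λ ∈ ℂ`: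

  `|∫ f(x) Re(Λ e_{Nη}(x))² dx - (‖Λ‖²/2) ∫ f| ≤ (L √d / N) · ‖Λ‖²/2`.

(The two-sided improved Hölder inequality at `p = 1` with the `(1/N)ℤ^d`-invariant weight
`Re(Λe_{Nη})² ≥ 0`, whose integral is `‖Λ‖²/2`.) In the paper `f = φ̃_j²(M_k ·)` (so `B = 1`,
`L ∝ M_k/δ₀`), `Λ` is unimodular and `N = N_k ≫ M_k`, giving `A_{j,k} = ½⨍φ̃_j² + O(M_k/N_k) ∼ δ`.
[cite: CoiculescuPalasek2025, Lemma 3.2 (4) (proof)] -/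
theorem abs_integral_mul_shearPhase_sq_sub_le {N : ℕ} (hN : 0 < N) {η : d → ℤ} (hη : η ≠ 0)
    (Λ : ℂ) {f : UnitAddTorus d → ℝ} {B L : ℝ} (hL : 0 ≤ L) (hfB : ∀ x, |f x| ≤ B)
    (hfL : ∀ y y' : EuclideanSpace ℝ d, |f (proj y) - f (proj y')| ≤ L * ‖y - y'‖) :
    |(∫ x, f x * shearPhase ((N : ℤ) • η) Λ x ^ 2) - ‖Λ‖ ^ 2 / 2 * ∫ x, f x| ≤
      L * (Real.sqrt (Fintype.card d) / N) * (‖Λ‖ ^ 2 / 2) := by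
  have hk : (N : ℤ) • η ≠ 0 := by
    intro h
    apply hη
    funext i
    have := congrFun h i
    simp only [Pi.smul_apply, smul_eq_mul, Pi.zero_apply, mul_eq_zero, Int.natCast_eq_zero] at this
    rcases this with h1 | h1
    · exact absurd h1 hN.ne'
    · exact h1
  have hgi : Integrable (fun x : UnitAddTorus d => shearPhase ((N : ℤ) • η) Λ x ^ 2) volume :=
    (continuous_shearPhase_sq _ Λ).integrable_of_hasCompactSupport
      (HasCompactSupport.of_compactSpace _)
  have h := abs_integral_mul_sub_le_of_latticeInvariant (f := f)
    (g := fun x => shearPhase ((N : ℤ) • η) Λ x ^ 2) hN hL hfB hfL (fun x => sq_nonneg _) hgi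
    (fun x κ => by simp only [shearPhase_add_proj_cellCorner hN η Λ x κ])
  rw [integral_shearPhase_sq hk] at h
  rwa [mul_comm (∫ x, f x) (‖Λ‖ ^ 2 / 2)] at h

end CP25

end Literature.Analysis.FluidPDE
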